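import Summits.CriticalPhenomena.Ising3DConformalLimit.Theses.EnergyNotSigmaSquared

/-!
# `CruxesGiveTarget` — the glue from the four chain items to the route target

Route `route-CriticalPhenomena-EnergyNotSigmaSquared`, item `stmt-CriticalPhenomena-14286`.

The route target `Target` is, verbatim, the conjunction
`EnergyGapPowerLaw ∧ GapForcesFarMerging ∧ FarMergingGivesU4 ∧ MoebiusLimit`
with the four definientia inlined.  The support item `CruxesGiveTarget` asks for the
implication `GapForcesFarMerging → EnergyGapPowerLaw → FarMergingGivesU4 → MoebiusLimit → Target`,
which is pure logic: reorder the hypotheses into the conjunction.  No mathematics is involved.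
-/

namespace Summit.CriticalPhenomena.Ising3DConformalLimit.Theorems

open Summit.CriticalPhenomena.Ising3DConformalLimit.Theses.EnergyNotSigmaSquared

/-- **Glue item `stmt-CriticalPhenomena-14286`.**  The four chain items of the route
`EnergyNotSigmaSquared` — TRANSFER (`GapForcesFarMerging`), GAP (`EnergyGapPowerLaw`),
GLUE (`FarMergingGivesU4`) and ML (`MoebiusLimit`) — give the route target `Target`, which is by
definition the conjunction GAP ∧ TRANSFER ∧ GLUE ∧ ML of their definientia.  Pure logic. -/
theorem cruxesGiveTarget_proof :
    Summit.CriticalPhenomena.Ising3DConformalLimit.Theses.EnergyNotSigmaSquared.CruxesGiveTarget := by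
  unfold CruxesGiveTarget
  intro hTransfer hGap hGlue hML
  exact ⟨hGap, hTransfer, hGlue, hML⟩

end Summit.CriticalPhenomena.Ising3DConformalLimit.Theorems
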